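import Summits.ValiantsHypothesis.ValiantsHypothesis.Theorems.LacunarySymmetroidMatrixDescartesDoorA26WallBubblingThirdShiftValues
import Summits.ValiantsHypothesis.ValiantsHypothesis.Theorems.LacunarySymmetroidMatrixDescartesDoorA26WallBubblingOrderThreeDichotomy

/-!
# `DoorA26` / line `wall_bubbling` — THE FIRST KERNEL NO-BALANCE AT ORDER 3: one triple zero, at most six touches, none parallel to `p⋆` ⇒ LIFT

HONEST FRAMING.  Object-search cell `pub-symmetroid`, crux `Theses.LacunarySymmetroid.DoorA26` (stmt-ValiantsHypothesis-19979; OPEN, typed,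
never asserted).  W2 seat val-sym-door-p1 g20, file #91; def-free helper for obligation (R) of `Cruxes/DoorA26/Lines/wall_bubbling.lean`.
Imports #81 `…OrderThreeDichotomy` (lift, or a generalized balance) and #89 `…ThirdShiftValues` (`pol(X, φ·1) = φ·tr X`; #45's interpolation).

THE THEOREM (`mem_twentyLocus_of_orderThree_nonparallel`).  Symmetric letters at injective exponents; `F = det P`; separated points `z_j` of exact
orders `m_j ∈ {1,2,3}` with `Σ m_j ≥ 20`; exactly ONE triple zero `t⋆ = z_{j⋆}`, rank one (`tr P(t⋆) ≠ 0`); the touches (`m_j = 2`) are at most six (they sit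
among six distinct abscissae `u` through an injective slot map) and NONE is parallel to `p⋆ = P(t⋆)`: `pol(P(z_j), p⋆) ≠ 0`.  Then `δ ∈ TwentyLocus`.
Proof = g19's p⋆-centred test (memo g19 §7c (i⋆)) against the generalized balance of #81: the null ruling `Q = φ·p⋆` (φ a six-term sum) is an
admissible shift for every `φ` (`pol(p⋆,p⋆) = 2 det p⋆ = 0`, and the slope row at `t⋆` is `φ(t⋆)·pol(P′(t⋆), p⋆) = φ(t⋆)·F′(t⋆) = 0`), and its touch
rows are `φ(z_j)·pol(P(z_j), p⋆)`; interpolating `φ(z_j) = [j = j₀]` kills every touch multiplier; then the scalar ruling `Q = φ·1` with `φ(t⋆) = 0 ≠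
φ′(t⋆)` (`φ = e^{δ₀(t−t⋆)} − e^{δ₁(t−t⋆)}`) has slope row `φ′(t⋆)·tr p⋆ ≠ 0` and kills the triple-zero multiplier — so no balance exists, and #81 lifts.
This closes, in the kernel, every pattern `(3, 2^n, 1^{17−2n})` with `n ≤ 6` rank-one touches off the null direction of the triple zero; g19 §7c's
remaining cases (touches parallel to `p⋆` — at most three by #76; `|J| = 8`; the `|J| = 7` core) are what is left of order 3.

WHAT IS HERE.  `pol_smul_right_fin_two`, `expPencil_smul_const`, `coordLetter_smul_symm`, `hasDerivAt_expPencil_entry`, `deriv_det_expPencil_eq_pol`,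
`hasDerivAt_pol_expPencil_const`, ★★★ `mem_twentyLocus_of_orderThree_nonparallel`.  Nothing here bears on `DoorA26`, `DoorA34`, (W)/(M)/(R),
`MatrixDescartes` (18050) or `VP ≠ VNP`; registers unchanged.

[this work] the theorem (g19's (i⋆) test, typed against #81).
-/

set_option linter.dupNamespace false

namespace Summit.ValiantsHypothesis.ValiantsHypothesis.Theorems.LacunarySymmetroidMatrixDescartes.WallBubbling

open Finset Filter Topology
open Bubbling (TwentyLocus expSum)

/-! ## §1 Algebra of rulings -/

/-- `pol(X, φ·Y) = φ·pol(X, Y)` for `2 × 2` matrices. [folklore] -/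
theorem pol_smul_right_fin_two (X Y : Matrix (Fin 2) (Fin 2) ℝ) (φ : ℝ) :
    (X + φ • Y).det - X.det - (φ • Y).det = φ * ((X + Y).det - X.det - Y.det) := by
  simp only [Matrix.det_fin_two, Matrix.add_apply, Matrix.smul_apply, smul_eq_mul]
  ring

/-- The pencil of the letters `c_l·Y` is `φ(t)·Y`, `φ = Σ_l c_l e^{δ_l t}`. [folklore] -/
theorem expPencil_smul_const (δ : Fin 6 → ℝ) (c : Fin 6 → ℝ) (Y : Matrix (Fin 2) (Fin 2) ℝ) (t : ℝ) :
    (∑ l, Real.exp (δ l * t) • (c l • Y)) = (∑ l, c l * Real.exp (δ l * t)) • Y := by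
  rw [Finset.sum_smul]
  exact Finset.sum_congr rfl fun l _ => by rw [smul_smul, mul_comm]

/-- The coordinate letter of `(cY₀₀, cY₀₁, cY₁₁)` is `c·Y` for symmetric `Y`. [folklore] -/
theorem coordLetter_smul_symm (Y : Matrix (Fin 2) (Fin 2) ℝ) (hY : Y.IsSymm) (c : ℝ) :
    (!![c * Y 0 0, c * Y 0 1; c * Y 0 1, c * Y 1 1] : Matrix (Fin 2) (Fin 2) ℝ) = c • Y := by
  have h10 : Y 1 0 = Y 0 1 := by
    have := hY.apply 0 1
    exact this
  ext i j
  fin_cases i <;> fin_cases j <;> simp [Matrix.smul_apply, h10]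

/-! ## §2 Calculus of the pencil: entries, determinant, first variation against a constant matrix -/

/-- Entries of the pencil are differentiable with the entries of the `δ`-weighted pencil as derivatives. [folklore] -/
theorem hasDerivAt_expPencil_entry (δ : Fin 6 → ℝ) (S : Fin 6 → Matrix (Fin 2) (Fin 2) ℝ) (i j : Fin 2) (t : ℝ) :
    HasDerivAt (fun t => (∑ l, Real.exp (δ l * t) • S l) i j) (∑ l, δ l * Real.exp (δ l * t) * S l i j) t := by
  have h : (fun t => (∑ l, Real.exp (δ l * t) • S l) i j) = fun t => ∑ l, Real.exp (δ l * t) * S l i j := by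
    funext t; simp only [Matrix.sum_apply, Matrix.smul_apply, smul_eq_mul]
  rw [h]
  have hl : ∀ l, HasDerivAt (fun t => Real.exp (δ l * t) * S l i j) (δ l * Real.exp (δ l * t) * S l i j) t := by
    intro l
    have h1 : HasDerivAt (fun t => Real.exp (δ l * t)) (Real.exp (δ l * t) * (δ l * 1)) t :=
      ((hasDerivAt_id t).const_mul (δ l)).exp
    exact (h1.mul_const (S l i j)).congr_deriv (by ring)
  exact HasDerivAt.fun_sum (u := Finset.univ) (fun l _ => hl l)

/-- The derivative of the determinant of the pencil is the first variation against the `δ`-weighted pencil, written in entries. [folklore] -/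
theorem deriv_det_expPencil_eq_pol (δ : Fin 6 → ℝ) (S : Fin 6 → Matrix (Fin 2) (Fin 2) ℝ) (t : ℝ) :
    deriv (fun t => (∑ l, Real.exp (δ l * t) • S l).det) t
      = (∑ l, δ l * Real.exp (δ l * t) * S l 0 0) * (∑ l, Real.exp (δ l * t) • S l) 1 1
        + (∑ l, Real.exp (δ l * t) • S l) 0 0 * (∑ l, δ l * Real.exp (δ l * t) * S l 1 1)
        - ((∑ l, δ l * Real.exp (δ l * t) * S l 0 1) * (∑ l, Real.exp (δ l * t) • S l) 1 0
          + (∑ l, Real.exp (δ l * t) • S l) 0 1 * (∑ l, δ l * Real.exp (δ l * t) * S l 1 0)) := by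
  have hF : (fun t => (∑ l, Real.exp (δ l * t) • S l).det)
      = fun t => (∑ l, Real.exp (δ l * t) • S l) 0 0 * (∑ l, Real.exp (δ l * t) • S l) 1 1
          - (∑ l, Real.exp (δ l * t) • S l) 0 1 * (∑ l, Real.exp (δ l * t) • S l) 1 0 := by
    funext t; rw [Matrix.det_fin_two]
  rw [hF]
  exact (((hasDerivAt_expPencil_entry δ S 0 0 t).mul (hasDerivAt_expPencil_entry δ S 1 1 t)).sub
    ((hasDerivAt_expPencil_entry δ S 0 1 t).mul (hasDerivAt_expPencil_entry δ S 1 0 t))).deriv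

/-- The first variation of the pencil against a CONSTANT matrix `β` is differentiable, with derivative the first variation of the `δ`-weighted pencil
against `β` (in entries). [folklore] -/
theorem hasDerivAt_pol_expPencil_const (δ : Fin 6 → ℝ) (S : Fin 6 → Matrix (Fin 2) (Fin 2) ℝ) (β : Matrix (Fin 2) (Fin 2) ℝ) (t : ℝ) :
    HasDerivAt (fun t => ((∑ l, Real.exp (δ l * t) • S l) + β).det - (∑ l, Real.exp (δ l * t) • S l).det - β.det)
      ((∑ l, δ l * Real.exp (δ l * t) * S l 0 0) * β 1 1 + (∑ l, δ l * Real.exp (δ l * t) * S l 1 1) * β 0 0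
        - (∑ l, δ l * Real.exp (δ l * t) * S l 0 1) * β 1 0 - (∑ l, δ l * Real.exp (δ l * t) * S l 1 0) * β 0 1) t := by
  have hg : (fun t => ((∑ l, Real.exp (δ l * t) • S l) + β).det - (∑ l, Real.exp (δ l * t) • S l).det - β.det)
      = fun t => (∑ l, Real.exp (δ l * t) • S l) 0 0 * β 1 1 + (∑ l, Real.exp (δ l * t) • S l) 1 1 * β 0 0
          - (∑ l, Real.exp (δ l * t) • S l) 0 1 * β 1 0 - (∑ l, Real.exp (δ l * t) • S l) 1 0 * β 0 1 := by
    funext t; simp only [Matrix.det_fin_two, Matrix.add_apply]; ring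
  rw [hg]
  exact ((((hasDerivAt_expPencil_entry δ S 0 0 t).mul_const (β 1 1)).add ((hasDerivAt_expPencil_entry δ S 1 1 t).mul_const (β 0 0))).sub
    ((hasDerivAt_expPencil_entry δ S 0 1 t).mul_const (β 1 0))).sub ((hasDerivAt_expPencil_entry δ S 1 0 t).mul_const (β 0 1))

/-! ## §3 The theorem -/

/-- ★★★ **NO BALANCE AT ORDER 3, up to six non-parallel touches ⇒ LIFT** (see the module docstring for the reading and the proof). [this work] -/
theorem mem_twentyLocus_of_orderThree_nonparallel (δ : Fin 6 → ℝ) (hδ : Function.Injective δ) (S : Fin 6 → Matrix (Fin 2) (Fin 2) ℝ)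
    (hS : ∀ l, (S l).IsSymm)
    {r : ℕ} (z : Fin r → ℝ) {ρ : ℝ} (hρ : 0 < ρ) (hsep : ∀ i j : Fin r, i < j → z i + ρ ≤ z j - ρ)
    (m : Fin r → ℕ) (hm1 : ∀ j, 1 ≤ m j) (hm3 : ∀ j, m j ≤ 3) (hm : 20 ≤ ∑ j, m j)
    (hvan : ∀ j, ∀ i < m j, iteratedDeriv i (fun t => (∑ l, Real.exp (δ l * t) • S l).det) (z j) = 0)
    (htop : ∀ j, iteratedDeriv (m j) (fun t => (∑ l, Real.exp (δ l * t) • S l).det) (z j) ≠ 0)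
    (jstar : Fin r) (hjstar : m jstar = 3) (huniq : ∀ j, m j = 3 → j = jstar)
    (htr : (∑ l, Real.exp (δ l * z jstar) • S l).trace ≠ 0)
    (u : Fin 6 → ℝ) (hu : Function.Injective u) (slot : Fin r → Fin 6) (hslot : ∀ j, m j = 2 → u (slot j) = z j)
    (hslot_inj : ∀ j j', m j = 2 → m j' = 2 → slot j = slot j' → j = j')
    (hpol : ∀ j, m j = 2 → ((∑ l, Real.exp (δ l * z j) • S l) + (∑ l, Real.exp (δ l * z jstar) • S l)).det
      - (∑ l, Real.exp (δ l * z j) • S l).det - (∑ l, Real.exp (δ l * z jstar) • S l).det ≠ 0) :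
    δ ∈ TwentyLocus := by
  classical
  rcases mem_twentyLocus_or_generalizedBalance_orderThree δ S hS z hρ hsep m hm1 hm3 hm hvan htop with h | ⟨lam, hl0, hlne, hsimple, hbal⟩
  · exact h
  exfalso
  -- notation
  set P : ℝ → Matrix (Fin 2) (Fin 2) ℝ := fun t => ∑ l, Real.exp (δ l * t) • S l with hP
  set F : ℝ → ℝ := fun t => (P t).det with hF
  set tstar := z jstar with htstar
  set pstar : Matrix (Fin 2) (Fin 2) ℝ := P tstar with hpstar
  have hpsymm : pstar.IsSymm := isSymm_expPencil δ S hS tstar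
  have hdet0 : pstar.det = 0 := by
    have := hvan jstar 0 (by omega); rw [iteratedDeriv_zero] at this; exact this
  have hF1 : deriv F tstar = 0 := by
    have := hvan jstar 1 (by omega); rw [iteratedDeriv_one] at this; exact this
  -- the shift `φ·Y` in coordinates and its first variation
  have hshift : ∀ (c : Fin 6 → ℝ) (Y : Matrix (Fin 2) (Fin 2) ℝ), Y.IsSymm → ∀ t,
      (∑ l, Real.exp (δ l * t) • (!![(fun l => c l * Y 0 0) l, (fun l => c l * Y 0 1) l; (fun l => c l * Y 0 1) l, (fun l => c l * Y 1 1) l] :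
        Matrix (Fin 2) (Fin 2) ℝ)) = (∑ l, c l * Real.exp (δ l * t)) • Y := by
    intro c Y hY t
    rw [← expPencil_smul_const]
    exact Finset.sum_congr rfl fun l _ => by rw [coordLetter_smul_symm Y hY (c l)]
  -- STEP 1: every touch multiplier vanishes (ruling `Q = φ·p⋆`, `φ(z_j) = [j = j₀]`)
  have htouch : ∀ j₀, m j₀ = 2 → lam j₀ = 0 := by
    intro j₀ hj₀
    obtain ⟨c, hc⟩ := exists_expSum_interpolate δ hδ u hu (fun a => if a = slot j₀ then 1 else 0)
    -- the coordinate shift of `φ·p⋆`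
    let w : Fin 6 → Fin 3 → ℝ := fun l => ![c l * pstar 0 0, c l * pstar 0 1, c l * pstar 1 1]
    have hQ : ∀ t, (∑ l, Real.exp (δ l * t) • (!![w l 0, w l 1; w l 1, w l 2] : Matrix (Fin 2) (Fin 2) ℝ))
        = (∑ l, c l * Real.exp (δ l * t)) • pstar := by
      intro t
      have := hshift c pstar hpsymm t
      simpa only [w, Matrix.cons_val_zero, Matrix.cons_val_one, Matrix.head_cons, Matrix.cons_val_two, Matrix.tail_cons] using this
    have hc1 : ∀ t, ((∑ l, Real.exp (δ l * t) • S l) + (∑ l, Real.exp (δ l * t) • (!![w l 0, w l 1; w l 1, w l 2] : Matrix (Fin 2) (Fin 2) ℝ))).det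
        - (∑ l, Real.exp (δ l * t) • S l).det - (∑ l, Real.exp (δ l * t) • (!![w l 0, w l 1; w l 1, w l 2] : Matrix (Fin 2) (Fin 2) ℝ)).det
        = (∑ l, c l * Real.exp (δ l * t)) * ((P t + pstar).det - (P t).det - pstar.det) := by
      intro t; rw [hQ t, pol_smul_right_fin_two]
    -- admissibility at `t⋆`: `pol(p⋆, p⋆) = 2 det p⋆ = 0`
    have hpp : (pstar + pstar).det - pstar.det - pstar.det = 0 := by
      have : pstar + pstar = (2 : ℝ) • pstar := by rw [two_smul]
      rw [this, Matrix.det_smul, hdet0]; simp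
    have hadm : ∀ j, m j = 3 →
        ((∑ l, Real.exp (δ l * z j) • S l) + (∑ l, Real.exp (δ l * z j) • (!![w l 0, w l 1; w l 1, w l 2] : Matrix (Fin 2) (Fin 2) ℝ))).det
          - (∑ l, Real.exp (δ l * z j) • S l).det
          - (∑ l, Real.exp (δ l * z j) • (!![w l 0, w l 1; w l 1, w l 2] : Matrix (Fin 2) (Fin 2) ℝ)).det = 0 := by
      intro j hj
      rw [huniq j hj, hc1]
      show (∑ l, c l * Real.exp (δ l * tstar)) * ((pstar + pstar).det - pstar.det - pstar.det) = 0
      rw [hpp, mul_zero]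
    have hB := hbal w hadm
    -- evaluate the balance: the `t⋆` row vanishes, the touch rows are `φ(z_j)·pol(p_j, p⋆)`
    have hrow : ∀ j, lam j * (iteratedDeriv (m j) F (z j) *
        iteratedDeriv (m j - 2) (fun t => ((∑ l, Real.exp (δ l * t) • S l)
          + (∑ l, Real.exp (δ l * t) • (!![w l 0, w l 1; w l 1, w l 2] : Matrix (Fin 2) (Fin 2) ℝ))).det
          - (∑ l, Real.exp (δ l * t) • S l).det
          - (∑ l, Real.exp (δ l * t) • (!![w l 0, w l 1; w l 1, w l 2] : Matrix (Fin 2) (Fin 2) ℝ)).det) (z j))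
        = if j = j₀ then lam j₀ * (iteratedDeriv 2 F (z j₀) * ((P (z j₀) + pstar).det - (P (z j₀)).det - pstar.det)) else 0 := by
      intro j
      have hfun : (fun t => ((∑ l, Real.exp (δ l * t) • S l)
          + (∑ l, Real.exp (δ l * t) • (!![w l 0, w l 1; w l 1, w l 2] : Matrix (Fin 2) (Fin 2) ℝ))).det
          - (∑ l, Real.exp (δ l * t) • S l).det
          - (∑ l, Real.exp (δ l * t) • (!![w l 0, w l 1; w l 1, w l 2] : Matrix (Fin 2) (Fin 2) ℝ)).det)
          = fun t => (∑ l, c l * Real.exp (δ l * t)) * ((P t + pstar).det - (P t).det - pstar.det) := funext hc1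
      rw [hfun]
      rcases (by have := hm1 j; have := hm3 j; omega : m j = 1 ∨ m j = 2 ∨ m j = 3) with h | h | h
      · -- simple zero
        rw [hsimple j h, zero_mul]
        have : j ≠ j₀ := fun hj => by rw [hj, hj₀] at h; exact absurd h (by norm_num)
        rw [if_neg this]
      · -- touch: value row `φ(z_j)·pol(p_j,p⋆)` with `φ(z_j) = [j = j₀]`
        rw [h, show (2 : ℕ) - 2 = 0 from rfl, iteratedDeriv_zero]
        have hφ : (∑ l, c l * Real.exp (δ l * z j)) = if slot j = slot j₀ then 1 else 0 := by
          rw [← hslot j h]; exact hc (slot j)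
        by_cases hj : j = j₀
        · subst hj
          rw [if_pos rfl] at hφ
          rw [hφ, one_mul, if_pos rfl]
        · have hss : slot j ≠ slot j₀ := fun hs => hj (hslot_inj j j₀ h hj₀ hs)
          rw [if_neg hss] at hφ
          rw [hφ, zero_mul, mul_zero, mul_zero, if_neg hj]
      · -- the triple zero: slope row `φ′(t⋆)·pol(p⋆,p⋆) + φ(t⋆)·F′(t⋆) = 0`
        have hjj : j = jstar := huniq j h
        have hne : j ≠ j₀ := fun hj => by rw [hj] at h; rw [h] at hj₀; exact absurd hj₀ (by norm_num)
        rw [if_neg hne, h, show (3 : ℕ) - 2 = 1 from rfl, iteratedDeriv_one, hjj]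
        -- derivative of `φ · g` at `t⋆` with `g(t⋆) = 0` and `g′(t⋆) = F′(t⋆) = 0`
        have hφd : HasDerivAt (fun t => ∑ l, c l * Real.exp (δ l * t)) (∑ l, c l * (δ l * Real.exp (δ l * tstar))) tstar := by
          have hl : ∀ l, HasDerivAt (fun t => c l * Real.exp (δ l * t)) (c l * (δ l * Real.exp (δ l * tstar))) tstar := by
            intro l
            have h1 : HasDerivAt (fun t => Real.exp (δ l * t)) (Real.exp (δ l * tstar) * (δ l * 1)) tstar :=
              ((hasDerivAt_id tstar).const_mul (δ l)).exp
            exact (h1.const_mul (c l)).congr_deriv (by ring)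
          exact HasDerivAt.fun_sum (u := Finset.univ) (fun l _ => hl l)
        have hgd := hasDerivAt_pol_expPencil_const δ S pstar tstar
        -- `g′(t⋆) = F′(t⋆) = 0`
        have hg1 : (∑ l, δ l * Real.exp (δ l * tstar) * S l 0 0) * pstar 1 1 + (∑ l, δ l * Real.exp (δ l * tstar) * S l 1 1) * pstar 0 0
            - (∑ l, δ l * Real.exp (δ l * tstar) * S l 0 1) * pstar 1 0 - (∑ l, δ l * Real.exp (δ l * tstar) * S l 1 0) * pstar 0 1 = 0 := by
          have hd := deriv_det_expPencil_eq_pol δ S tstar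
          have h0 : deriv (fun t => (∑ l, Real.exp (δ l * t) • S l).det) tstar = 0 := hF1
          rw [h0] at hd
          show (∑ l, δ l * Real.exp (δ l * tstar) * S l 0 0) * (P tstar) 1 1 + (∑ l, δ l * Real.exp (δ l * tstar) * S l 1 1) * (P tstar) 0 0
            - (∑ l, δ l * Real.exp (δ l * tstar) * S l 0 1) * (P tstar) 1 0 - (∑ l, δ l * Real.exp (δ l * tstar) * S l 1 0) * (P tstar) 0 1 = 0
          simp only [hP] at hd ⊢
          linarith
        have hprod : HasDerivAt (fun t => (∑ l, c l * Real.exp (δ l * t)) * ((P t + pstar).det - (P t).det - pstar.det))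
            ((∑ l, c l * (δ l * Real.exp (δ l * tstar))) * ((P tstar + pstar).det - (P tstar).det - pstar.det)
              + (∑ l, c l * Real.exp (δ l * tstar)) *
                ((∑ l, δ l * Real.exp (δ l * tstar) * S l 0 0) * pstar 1 1 + (∑ l, δ l * Real.exp (δ l * tstar) * S l 1 1) * pstar 0 0
                  - (∑ l, δ l * Real.exp (δ l * tstar) * S l 0 1) * pstar 1 0 - (∑ l, δ l * Real.exp (δ l * tstar) * S l 1 0) * pstar 0 1)) tstar :=
          hφd.mul hgd
        rw [← htstar, hprod.deriv, hg1, mul_zero, add_zero]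
        have hg0 : (P tstar + pstar).det - (P tstar).det - pstar.det = 0 := hpp
        rw [hg0, mul_zero, mul_zero, mul_zero]
    rw [Finset.sum_congr rfl (fun j _ => hrow j), Finset.sum_ite_eq' Finset.univ j₀, if_pos (Finset.mem_univ _)] at hB
    -- conclude `lam j₀ = 0`
    have hA : iteratedDeriv 2 F (z j₀) ≠ 0 := by have := htop j₀; rwa [hj₀] at this
    have hp : (P (z j₀) + pstar).det - (P (z j₀)).det - pstar.det ≠ 0 := hpol j₀ hj₀
    rcases mul_eq_zero.1 hB with h | h
    · exact h
    · exact absurd h (mul_ne_zero hA hp)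
  -- STEP 2: the triple-zero multiplier vanishes (ruling `Q = φ·1`, `φ(t⋆) = 0 ≠ φ′(t⋆)`)
  have hstar : lam jstar = 0 := by
    have h01 : δ 0 ≠ δ 1 := fun h => absurd (hδ h) (by decide)
    let c : Fin 6 → ℝ := fun l => if l = 0 then Real.exp (-(δ 0 * tstar)) else if l = 1 then -Real.exp (-(δ 1 * tstar)) else 0
    have hφ : ∀ t, (∑ l, c l * Real.exp (δ l * t)) = Real.exp (δ 0 * (t - tstar)) - Real.exp (δ 1 * (t - tstar)) := by
      intro t
      simp only [c, Fin.sum_univ_six, if_true, show (1 : Fin 6) ≠ 0 by decide, show (2 : Fin 6) ≠ 0 by decide, show (2 : Fin 6) ≠ 1 by decide,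
        show (3 : Fin 6) ≠ 0 by decide, show (3 : Fin 6) ≠ 1 by decide, show (4 : Fin 6) ≠ 0 by decide, show (4 : Fin 6) ≠ 1 by decide,
        show (5 : Fin 6) ≠ 0 by decide, show (5 : Fin 6) ≠ 1 by decide, if_false, zero_mul, add_zero]
      rw [mul_sub, mul_sub, Real.exp_sub, Real.exp_sub, Real.exp_neg, Real.exp_neg]
      field_simp
      ring
    have hφ0 : (∑ l, c l * Real.exp (δ l * tstar)) = 0 := by rw [hφ]; simp
    have hφd : HasDerivAt (fun t => ∑ l, c l * Real.exp (δ l * t)) (δ 0 - δ 1) tstar := by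
      have hfun : (fun t => ∑ l, c l * Real.exp (δ l * t)) = fun t => Real.exp (δ 0 * (t - tstar)) - Real.exp (δ 1 * (t - tstar)) := funext hφ
      rw [hfun]
      have h0 : HasDerivAt (fun t => Real.exp (δ 0 * (t - tstar))) (Real.exp (δ 0 * (tstar - tstar)) * (δ 0 * 1)) tstar :=
        (((hasDerivAt_id tstar).sub_const tstar).const_mul (δ 0)).exp
      have h1 : HasDerivAt (fun t => Real.exp (δ 1 * (t - tstar))) (Real.exp (δ 1 * (tstar - tstar)) * (δ 1 * 1)) tstar :=
        (((hasDerivAt_id tstar).sub_const tstar).const_mul (δ 1)).exp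
      exact (h0.sub h1).congr_deriv (by simp)
    -- the coordinate shift of `φ·1`
    let w : Fin 6 → Fin 3 → ℝ := fun l => ![c l * (1 : Matrix (Fin 2) (Fin 2) ℝ) 0 0, c l * (1 : Matrix (Fin 2) (Fin 2) ℝ) 0 1,
      c l * (1 : Matrix (Fin 2) (Fin 2) ℝ) 1 1]
    have hQ : ∀ t, (∑ l, Real.exp (δ l * t) • (!![w l 0, w l 1; w l 1, w l 2] : Matrix (Fin 2) (Fin 2) ℝ))
        = (∑ l, c l * Real.exp (δ l * t)) • (1 : Matrix (Fin 2) (Fin 2) ℝ) := by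
      intro t
      have := hshift c 1 Matrix.isSymm_one t
      simpa only [w, Matrix.cons_val_zero, Matrix.cons_val_one, Matrix.head_cons, Matrix.cons_val_two, Matrix.tail_cons] using this
    have hc1 : ∀ t, ((∑ l, Real.exp (δ l * t) • S l) + (∑ l, Real.exp (δ l * t) • (!![w l 0, w l 1; w l 1, w l 2] : Matrix (Fin 2) (Fin 2) ℝ))).det
        - (∑ l, Real.exp (δ l * t) • S l).det - (∑ l, Real.exp (δ l * t) • (!![w l 0, w l 1; w l 1, w l 2] : Matrix (Fin 2) (Fin 2) ℝ)).det
        = (∑ l, c l * Real.exp (δ l * t)) * (P t).trace := by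
      intro t; rw [hQ t, pol_smul_one_fin_two]
    have hadm : ∀ j, m j = 3 →
        ((∑ l, Real.exp (δ l * z j) • S l) + (∑ l, Real.exp (δ l * z j) • (!![w l 0, w l 1; w l 1, w l 2] : Matrix (Fin 2) (Fin 2) ℝ))).det
          - (∑ l, Real.exp (δ l * z j) • S l).det
          - (∑ l, Real.exp (δ l * z j) • (!![w l 0, w l 1; w l 1, w l 2] : Matrix (Fin 2) (Fin 2) ℝ)).det = 0 := by
      intro j hj
      rw [huniq j hj, hc1]
      show (∑ l, c l * Real.exp (δ l * tstar)) * (P tstar).trace = 0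
      rw [hφ0, zero_mul]
    have hB := hbal w hadm
    have hrow : ∀ j, lam j * (iteratedDeriv (m j) F (z j) *
        iteratedDeriv (m j - 2) (fun t => ((∑ l, Real.exp (δ l * t) • S l)
          + (∑ l, Real.exp (δ l * t) • (!![w l 0, w l 1; w l 1, w l 2] : Matrix (Fin 2) (Fin 2) ℝ))).det
          - (∑ l, Real.exp (δ l * t) • S l).det
          - (∑ l, Real.exp (δ l * t) • (!![w l 0, w l 1; w l 1, w l 2] : Matrix (Fin 2) (Fin 2) ℝ)).det) (z j))
        = if j = jstar then lam jstar * (iteratedDeriv 3 F tstar * ((δ 0 - δ 1) * pstar.trace)) else 0 := by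
      intro j
      have hfun : (fun t => ((∑ l, Real.exp (δ l * t) • S l)
          + (∑ l, Real.exp (δ l * t) • (!![w l 0, w l 1; w l 1, w l 2] : Matrix (Fin 2) (Fin 2) ℝ))).det
          - (∑ l, Real.exp (δ l * t) • S l).det
          - (∑ l, Real.exp (δ l * t) • (!![w l 0, w l 1; w l 1, w l 2] : Matrix (Fin 2) (Fin 2) ℝ)).det)
          = fun t => (∑ l, c l * Real.exp (δ l * t)) * (P t).trace := funext hc1
      rw [hfun]
      rcases (by have := hm1 j; have := hm3 j; omega : m j = 1 ∨ m j = 2 ∨ m j = 3) with h | h | h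
      · rw [hsimple j h, zero_mul]
        have : j ≠ jstar := fun hj => by rw [hj, hjstar] at h; exact absurd h (by norm_num)
        rw [if_neg this]
      · rw [htouch j h, zero_mul]
        have : j ≠ jstar := fun hj => by rw [hj, hjstar] at h; exact absurd h (by norm_num)
        rw [if_neg this]
      · have hjj : j = jstar := huniq j h
        rw [h, show (3 : ℕ) - 2 = 1 from rfl, iteratedDeriv_one, if_pos hjj, hjj]
        -- derivative of `φ · tr P` at `t⋆` with `φ(t⋆) = 0`
        have htrd : HasDerivAt (fun t => (P t).trace)
            ((∑ l, δ l * Real.exp (δ l * tstar) * S l 0 0) + (∑ l, δ l * Real.exp (δ l * tstar) * S l 1 1)) tstar := by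
          have hfun : (fun t => (P t).trace) = fun t => (∑ l, Real.exp (δ l * t) • S l) 0 0 + (∑ l, Real.exp (δ l * t) • S l) 1 1 := by
            funext t; rw [Matrix.trace_fin_two]
          rw [hfun]
          exact (hasDerivAt_expPencil_entry δ S 0 0 tstar).add (hasDerivAt_expPencil_entry δ S 1 1 tstar)
        have hprod : HasDerivAt (fun t => (∑ l, c l * Real.exp (δ l * t)) * (P t).trace)
            ((δ 0 - δ 1) * (P tstar).trace + (∑ l, c l * Real.exp (δ l * tstar)) *
              ((∑ l, δ l * Real.exp (δ l * tstar) * S l 0 0) + (∑ l, δ l * Real.exp (δ l * tstar) * S l 1 1))) tstar := hφd.mul htrd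
        rw [← htstar, hprod.deriv, hφ0, zero_mul, add_zero]
    rw [Finset.sum_congr rfl (fun j _ => hrow j), Finset.sum_ite_eq' Finset.univ jstar, if_pos (Finset.mem_univ _)] at hB
    have hA : iteratedDeriv 3 F tstar ≠ 0 := by have := htop jstar; rwa [hjstar] at this
    have hd : (δ 0 - δ 1) * pstar.trace ≠ 0 := mul_ne_zero (sub_ne_zero.2 h01) htr
    rcases mul_eq_zero.1 hB with h | h
    · exact h
    · exact absurd h (mul_ne_zero hA hd)
  -- all multipliers vanish
  apply hlne
  funext j
  rcases (by have := hm1 j; have := hm3 j; omega : m j = 1 ∨ m j = 2 ∨ m j = 3) with h | h | h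
  · exact hsimple j h
  · exact htouch j h
  · rw [huniq j h]; exact hstar

end Summit.ValiantsHypothesis.ValiantsHypothesis.Theorems.LacunarySymmetroidMatrixDescartes.WallBubbling
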